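import Literature.NumberTheory.DiophantineApproximation.PolylogShiftFourBridge
import Mathlib.Analysis.SumOverResidueClass
import HarnessLib

/-!
# The divisor bridge: `Li_s(±1/N^d)` through the shifted series `Φ_{s,r}(1/N^m)` for `d ∣ m`

Topic `Literature/NumberTheory/DiophantineApproximation`. The general form of the `m = 4` bridge
`PolylogShiftFourBridge.lean`: for integers `N ≥ 2`, `d ≥ 1`, `e ≥ 1` and `m = d e`, the real polylogarithm
values `Li_s(1/N^d) = ∑_{n ≥ 1} N^{−dn}/n^s` (`DilogPade.polylogSeries s (1/N^d)`) and — when `m/d = 2e` is even —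
`Li_s(−1/N^d)` are explicit combinations of the `m` shifted polylogarithm-type series
`Φ_{s,r}(y) = ∑_{k ≥ 0} y^{k+1}/(mk + r)^s` (`ShiftPade.lerchShift m r s y`, `r = 1, …, m`) at the ONE point `y = 1/N^m`:

* `polylogSeries_pow_eq_lerchShift` — `Li_s(1/N^d) = ∑_{t < e} d^s N^{m − d(t+1)} Φ_{s, d(t+1)}(1/N^m)` (`m = d e`);
* `polylogSeries_neg_pow_eq_lerchShift` —
  `Li_s(−1/N^d) = ∑_{t < 2e} (−1)^{t+1} d^s N^{m − d(t+1)} Φ_{s, d(t+1)}(1/N^m)` (`m = 2 d e`);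
* the same two identities collected over the residues `r + 1 ≤ m` with the divisibility indicator
  (`polylogSeries_pow_eq_sum_ite`, `polylogSeries_neg_pow_eq_sum_ite`:
  coefficient of `Φ_{s,r+1}` = `[d ∣ r+1] (±1)^{(r+1)/d} d^s N^{m−(r+1)}`), and the case `d = 1`:
  `Li_s(1/N) = ∑_{r < m} N^{m−(r+1)} Φ_{s,r+1}(1/N^m)` (`polylogSeries_eq_sum_lerchShift`);
* the two pieces of bookkeeping behind them: a summable series over `ℕ` is the sum of its residue-class
  subseries (`tsum_eq_sum_range_tsum_residue`, `Nat.sumByResidueClasses` as a `Finset.range` sum) and the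
  reindexing `∑_{r < de} [d ∣ r+1] g(r+1) = ∑_{t < e} g(d(t+1))` (`sum_range_ite_dvd`).

The computation is the one of the `m = 4` file: split `Li_s(x) = ∑_{n ≥ 0} x^{n+1}/(n+1)^s` (`x = ±1/N^d`) over the
classes `n = t + e k` (`t < e`; `2e` classes for the sign, on which `(−1)^{n+1} = (−1)^{t+1}` is constant); on the
class `t`, `N^{−d(t + ek + 1)} = N^{m − d(t+1)} (1/N^m)^{k+1}` and `(t + ek + 1)^s = (mk + d(t+1))^s / d^s`.
For `m = 2^h` these identities express `Li_s(1/N)` and `Li_s(−1/N^{2^i})` (`i < h`) — the values carried by the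
duplication tower of height `h` of the Kontsevich–Zagier box sectors — in the basis `Φ_{s,r}(1/N^{2^h})`, whose
`ℚ`-linear independence (with `1`) is `one_lerchShift_linearIndependent` (`PolylogShiftLinearIndependence.lean`).

References: S. David, N. Hirata-Kohno, M. Kawashima, *Can polylogarithms at algebraic points be linearly
independent?*, Moscow J. Comb. Number Th. 9 (2020), Thm 2.1 (the identity `Li_s(ζx) = ∑_r ζ^r x^{r−m} Φ_{s,r}(x^m)`,
`ζ^m = 1`, at `x = 1/N^d`, `ζ = ±1`, read in the variable `x^{1/d}`). Everything here is PROVED from Mathlib's `tsum`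
API; no definitions, no named facts.
-/

noncomputable section

open Finset

namespace Literature.NumberTheory.DiophantineApproximation

namespace ShiftPade

/-- A summable real series over `ℕ` is the sum of its `e + 1` residue-class subseries:
`∑_n f(n) = ∑_{t ≤ e} ∑_k f(t + (e+1)k)` (`Nat.sumByResidueClasses`, the sum over `ZMod (e+1) = Fin (e+1)`
rewritten as a sum over `Finset.range (e+1)`). [folklore] -/
theorem tsum_eq_sum_range_tsum_residue {f : ℕ → ℝ} (hf : Summable f) (e : ℕ) :
    ∑' n, f n = ∑ t ∈ range (e + 1), ∑' k, f (t + (e + 1) * k) := by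
  rw [Nat.sumByResidueClasses hf (e + 1)]
  exact Fin.sum_univ_eq_sum_range (fun t => ∑' k, f (t + (e + 1) * k)) (e + 1)

/-- Reindexing a sum supported on the multiples of `d ≥ 1`:
`∑_{r < de} [d ∣ r+1] g(r+1) = ∑_{t < e} g(d(t+1))` (in each block `de' ≤ r < de' + d` exactly the last index
has `d ∣ r + 1`). [folklore] -/
theorem sum_range_ite_dvd {M : Type*} [AddCommMonoid M] {d : ℕ} (hd : 1 ≤ d) (e : ℕ) (g : ℕ → M) :
    ∑ r ∈ range (d * e), (if d ∣ r + 1 then g (r + 1) else 0) = ∑ t ∈ range e, g (d * (t + 1)) := by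
  induction e with
  | zero => simp
  | succ e ih =>
    rw [Nat.mul_succ, sum_range_add, ih, sum_range_succ]
    congr 1
    rw [sum_eq_single_of_mem (d - 1) (mem_range.2 (by omega))]
    · have h1 : d * e + (d - 1) + 1 = d * (e + 1) := by rw [Nat.mul_succ]; omega
      rw [h1, if_pos (dvd_mul_right d (e + 1))]
    · intro x hx hne
      rw [if_neg]
      intro hdvd
      rw [add_assoc, Nat.dvd_add_right (dvd_mul_right d e)] at hdvd
      have h1 := Nat.le_of_dvd (Nat.succ_pos x) hdvd
      have h2 := mem_range.1 hx
      omega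

/-- The powers of `1/N^d` along the residue class `t` mod `e` (`t < e`, `N ≥ 2`):
`(1/N^d)^{t + ek + 1} = N^{de − d(t+1)} (1/N^{de})^{k+1}`, since `de(k+1) = (de − d(t+1)) + d(t + ek + 1)`.
[folklore] -/
theorem one_div_pow_pow_residue {N : ℕ} (hN : 2 ≤ N) {d e t : ℕ} (ht : t < e) (k : ℕ) :
    (1 / (N : ℝ) ^ d) ^ (t + e * k + 1) =
      (N : ℝ) ^ (d * e - d * (t + 1)) * (1 / (N : ℝ) ^ (d * e)) ^ (k + 1) := by
  have hN0 : (N : ℝ) ≠ 0 := by positivity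
  obtain ⟨c, rfl⟩ : ∃ c, e = t + 1 + c := ⟨e - (t + 1), by omega⟩
  have hsub : d * (t + 1 + c) - d * (t + 1) = d * c := by
    rw [Nat.mul_add, Nat.add_sub_cancel_left]
  rw [hsub, one_div_pow, one_div_pow, ← pow_mul, ← pow_mul, mul_one_div,
    div_eq_div_iff (pow_ne_zero _ hN0) (pow_ne_zero _ hN0), one_mul, ← pow_add]
  congr 1
  ring

/-- `0 ≤ 1/N^d < 1` for `N ≥ 2`, `d ≥ 1`. [folklore] -/
theorem one_div_pow_lt_one {N : ℕ} (hN : 2 ≤ N) {d : ℕ} (hd : 1 ≤ d) : 1 / (N : ℝ) ^ d < 1 := by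
  rw [div_lt_one (by positivity)]
  have h1 : (1 : ℝ) < N := by exact_mod_cast hN
  exact one_lt_pow₀ h1 (by omega)

/-- The class-`t` denominators: `(t + ek) + 1 = ((de) k + d(t+1)) / d` for `d ≥ 1`. [folklore] -/
theorem residue_denominator {d : ℕ} (hd : 1 ≤ d) (e t k : ℕ) :
    ((t + e * k : ℕ) : ℝ) + 1 = (((d * e : ℕ) : ℝ) * k + ((d * (t + 1) : ℕ) : ℝ)) / d := by
  have hd0 : (d : ℝ) ≠ 0 := by exact_mod_cast (show d ≠ 0 by omega)
  field_simp
  push_cast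
  ring

/-- **The divisor bridge at `1/N^d`**: for `N ≥ 2`, `d, e ≥ 1` and `m = de`,
`Li_s(1/N^d) = ∑_{t < e} d^s N^{m − d(t+1)} Φ_{s, d(t+1)}(1/N^m)` (split `∑_n N^{−d(n+1)}/(n+1)^s` over
`n mod e`). [cite: DavidHirataKohnoKawashima2020, Thm 2.1] -/
theorem polylogSeries_pow_eq_lerchShift (s : ℕ) {N : ℕ} (hN : 2 ≤ N) {m d e : ℕ} (hd : 1 ≤ d)
    (he : 1 ≤ e) (hm : m = d * e) :
    DilogPade.polylogSeries s (1 / (N : ℝ) ^ d) =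
      ∑ t ∈ range e, (d : ℝ) ^ s * (N : ℝ) ^ (m - d * (t + 1)) *
        lerchShift m (d * (t + 1)) s (1 / (N : ℝ) ^ m) := by
  subst hm
  obtain ⟨e, rfl⟩ : ∃ e', e = e' + 1 := ⟨e - 1, by omega⟩
  have hx0 : (0 : ℝ) ≤ 1 / (N : ℝ) ^ d := by positivity
  rw [DilogPade.polylogSeries, tsum_eq_sum_range_tsum_residue
    (DilogPade.summable_polylogSeries s hx0 (one_div_pow_lt_one hN hd)) e]
  refine sum_congr rfl fun t ht => ?_
  rw [lerchShift, ← tsum_mul_left]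
  refine tsum_congr fun k => ?_
  have hd0 : (d : ℝ) ≠ 0 := by exact_mod_cast (show d ≠ 0 by omega)
  have hDpos : (0 : ℝ) < ((d * (e + 1) : ℕ) : ℝ) * k + ((d * (t + 1) : ℕ) : ℝ) := by
    have h1 : (0 : ℝ) < ((d * (t + 1) : ℕ) : ℝ) := by
      exact_mod_cast Nat.mul_pos (by omega) (Nat.succ_pos t)
    have h2 : (0 : ℝ) ≤ ((d * (e + 1) : ℕ) : ℝ) * k := by positivity
    linarith
  rw [one_div_pow_pow_residue hN (mem_range.1 ht) k, residue_denominator hd (e + 1) t k,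
    div_pow _ (d : ℝ) s]
  field_simp

/-- The sign of the powers of `−x` is constant along a residue class mod `2e`:
`(−x)^{t + 2ek + 1} = (−1)^{t+1} x^{t + 2ek + 1}`. [folklore] -/
theorem neg_pow_residue (x : ℝ) (t e k : ℕ) :
    (-x) ^ (t + 2 * e * k + 1) = (-1) ^ (t + 1) * x ^ (t + 2 * e * k + 1) := by
  rw [neg_pow, show t + 2 * e * k + 1 = (t + 1) + 2 * (e * k) by ring, pow_add (-1 : ℝ) (t + 1),
    pow_mul, neg_one_sq, one_pow, mul_one]

/-- **The divisor bridge at `−1/N^d`** (even co-divisor): for `N ≥ 2`, `d, e ≥ 1` and `m = 2de`,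
`Li_s(−1/N^d) = ∑_{t < 2e} (−1)^{t+1} d^s N^{m − d(t+1)} Φ_{s, d(t+1)}(1/N^m)` (split over `n mod 2e`, on each
class the sign `(−1)^{n+1}` is constant). [cite: DavidHirataKohnoKawashima2020, Thm 2.1] -/
theorem polylogSeries_neg_pow_eq_lerchShift (s : ℕ) {N : ℕ} (hN : 2 ≤ N) {m d e : ℕ} (hd : 1 ≤ d)
    (he : 1 ≤ e) (hm : m = d * (2 * e)) :
    DilogPade.polylogSeries s (-(1 / (N : ℝ) ^ d)) =
      ∑ t ∈ range (2 * e), (-1) ^ (t + 1) * (d : ℝ) ^ s * (N : ℝ) ^ (m - d * (t + 1)) *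
        lerchShift m (d * (t + 1)) s (1 / (N : ℝ) ^ m) := by
  subst hm
  obtain ⟨E, hE⟩ : ∃ E, 2 * e = E + 1 := ⟨2 * e - 1, by omega⟩
  have hx0 : (0 : ℝ) ≤ 1 / (N : ℝ) ^ d := by positivity
  have hsum : Summable fun k : ℕ => (-(1 / (N : ℝ) ^ d)) ^ (k + 1) / ((k : ℝ) + 1) ^ s := by
    refine Summable.of_norm ((DilogPade.summable_polylogSeries s hx0
      (one_div_pow_lt_one hN hd)).congr fun k => ?_)
    rw [norm_div, norm_pow, norm_pow, norm_neg, Real.norm_of_nonneg hx0,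
      Real.norm_of_nonneg (by positivity : (0 : ℝ) ≤ (k : ℝ) + 1)]
  rw [DilogPade.polylogSeries, hE, tsum_eq_sum_range_tsum_residue hsum E]
  refine sum_congr rfl fun t ht => ?_
  rw [lerchShift, ← tsum_mul_left]
  refine tsum_congr fun k => ?_
  have hd0 : (d : ℝ) ≠ 0 := by exact_mod_cast (show d ≠ 0 by omega)
  have hDpos : (0 : ℝ) < ((d * (E + 1) : ℕ) : ℝ) * k + ((d * (t + 1) : ℕ) : ℝ) := by
    have h1 : (0 : ℝ) < ((d * (t + 1) : ℕ) : ℝ) := by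
      exact_mod_cast Nat.mul_pos (by omega) (Nat.succ_pos t)
    have h2 : (0 : ℝ) ≤ ((d * (E + 1) : ℕ) : ℝ) * k := by positivity
    linarith
  have hsign : (-(1 / (N : ℝ) ^ d)) ^ (t + (E + 1) * k + 1) =
      (-1) ^ (t + 1) * (1 / (N : ℝ) ^ d) ^ (t + (E + 1) * k + 1) := by
    rw [← hE, show t + 2 * e * k + 1 = t + 2 * e * k + 1 from rfl, neg_pow_residue]
  rw [hsign, one_div_pow_pow_residue hN (mem_range.1 ht) k, residue_denominator hd (E + 1) t k,
    div_pow _ (d : ℝ) s]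
  field_simp

/-- **The divisor bridge at `1/N^d`, collected over residues**: for `N ≥ 2`, `d, e ≥ 1`, `m = de`,
`Li_s(1/N^d) = ∑_{r < m} [d ∣ r+1] d^s N^{m−(r+1)} Φ_{s,r+1}(1/N^m)`. [cite: DavidHirataKohnoKawashima2020, Thm 2.1] -/
theorem polylogSeries_pow_eq_sum_ite (s : ℕ) {N : ℕ} (hN : 2 ≤ N) {m d e : ℕ} (hd : 1 ≤ d)
    (he : 1 ≤ e) (hm : m = d * e) :
    DilogPade.polylogSeries s (1 / (N : ℝ) ^ d) =
      ∑ r ∈ range m, (if d ∣ r + 1 then (d : ℝ) ^ s * (N : ℝ) ^ (m - (r + 1)) else 0) *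
        lerchShift m (r + 1) s (1 / (N : ℝ) ^ m) := by
  rw [polylogSeries_pow_eq_lerchShift s hN hd he hm]
  subst hm
  refine Eq.trans ?_ ((sum_range_ite_dvd hd e fun n =>
    (d : ℝ) ^ s * (N : ℝ) ^ (d * e - n) * lerchShift (d * e) n s (1 / (N : ℝ) ^ (d * e))).symm.trans ?_)
  · rfl
  · refine sum_congr rfl fun r _ => ?_
    rw [ite_mul, zero_mul]

/-- **The divisor bridge at `−1/N^d`, collected over residues**: for `N ≥ 2`, `d, e ≥ 1`, `m = 2de`,
`Li_s(−1/N^d) = ∑_{r < m} [d ∣ r+1] (−1)^{(r+1)/d} d^s N^{m−(r+1)} Φ_{s,r+1}(1/N^m)`.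
[cite: DavidHirataKohnoKawashima2020, Thm 2.1] -/
theorem polylogSeries_neg_pow_eq_sum_ite (s : ℕ) {N : ℕ} (hN : 2 ≤ N) {m d e : ℕ} (hd : 1 ≤ d)
    (he : 1 ≤ e) (hm : m = d * (2 * e)) :
    DilogPade.polylogSeries s (-(1 / (N : ℝ) ^ d)) =
      ∑ r ∈ range m, (if d ∣ r + 1 then
          (-1) ^ ((r + 1) / d) * (d : ℝ) ^ s * (N : ℝ) ^ (m - (r + 1)) else 0) *
        lerchShift m (r + 1) s (1 / (N : ℝ) ^ m) := by
  rw [polylogSeries_neg_pow_eq_lerchShift s hN hd he hm]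
  subst hm
  refine Eq.trans ?_ ((sum_range_ite_dvd hd (2 * e) fun n =>
    (-1) ^ (n / d) * (d : ℝ) ^ s * (N : ℝ) ^ (d * (2 * e) - n) *
      lerchShift (d * (2 * e)) n s (1 / (N : ℝ) ^ (d * (2 * e)))).symm.trans ?_)
  · refine sum_congr rfl fun t _ => ?_
    simp only [Nat.mul_div_cancel_left _ (show 0 < d by omega)]
  · refine sum_congr rfl fun r _ => ?_
    rw [ite_mul, zero_mul]

/-- **The case `d = 1`**: for `N ≥ 2` and `m ≥ 1`, `Li_s(1/N) = ∑_{r < m} N^{m−(r+1)} Φ_{s,r+1}(1/N^m)`.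
[cite: DavidHirataKohnoKawashima2020, Thm 2.1] -/
theorem polylogSeries_eq_sum_lerchShift (s : ℕ) {N : ℕ} (hN : 2 ≤ N) (m : ℕ) (hm : 1 ≤ m) :
    DilogPade.polylogSeries s (1 / (N : ℝ)) =
      ∑ r ∈ range m, (N : ℝ) ^ (m - (r + 1)) * lerchShift m (r + 1) s (1 / (N : ℝ) ^ m) := by
  have h := polylogSeries_pow_eq_lerchShift s hN (le_refl 1) hm (one_mul m).symm
  rw [pow_one] at h
  rw [h]
  refine sum_congr rfl fun r _ => ?_
  rw [Nat.cast_one, one_pow, one_mul, one_mul]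

end ShiftPade

end Literature.NumberTheory.DiophantineApproximation
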